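import Literature.Topology.FourManifolds.SurgeryTraceOrientation
import Literature.Topology.FourManifolds.SurgeryConnected
import HarnessLib

/-!
# Kirby's `W₁ = M × I ∪ 2-handles`, one circle at a time

Topic `Literature/Topology/FourManifolds` (fact seat of
`Literature.Topology.FourManifolds.isOrientedBordant_of_isEmpty_of_signature_eq_zero`, Kirby
1989, Cor. IX.2 with VIII Thm 1(A)).  The first sentence of Kirby's proof of VIII Thm 1(A) —
*"`W₁ = M × I ∪ 2-handles`"* (surgery on circles of the connected closed oriented `M⁴`, through
an oriented bordism, keeping the signature) — assembled from the oriented trace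
(`SurgeryTraceOrientation.lean`, Milnor 1965 Thm. 3.12), the bordism invariance of the signature
(`SignatureBordismInvariance.lean`, Thom 1954 Thm. IV.1) and the connectedness of surgered
manifolds (`SurgeryConnected.lean`, Milnor 1965 §8):

* `exists_connectedSpace_isSurgery_isOrientedBordant_signature_eq` — **for a connected closed
  smooth `ℤ`-oriented `4`-manifold `(M, μ)` and a framed circle `φ : S¹ × ℝ³ ↪ M` there is a
  CONNECTED closed smooth `4`-manifold `M′`, obtained from `M` by surgery along `φ`, with a
  `ℤ`-orientation `μ′` such that `(M, μ) ∼ (M′, μ′)` are oriented-bordant and `σ(M′) = σ(M)`**;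
  so the step can be iterated along any finite list of circles chosen one after the other.

Everything is proved; no named facts.

## References

* R. C. Kirby, *The Topology of 4-Manifolds*, LNM 1374 (1989), Ch. VIII Thm 1(A) (proof),
  Cor. IX.2. [Kirby1989]
* J. Milnor, *Lectures on the h-cobordism theorem* (1965), Thm. 3.12, §8. [MilnorHCobordism1965]
-/

noncomputable section

open scoped Manifold ContDiff Topology
open Set Function Module
open Literature.AlgebraicTopology.SingularHomology

namespace Literature.Topology.FourManifolds

/-- Local notation: `𝔼 n` is the model Euclidean space `EuclideanSpace ℝ (Fin n)`. -/
local notation "𝔼 " n:arg => EuclideanSpace ℝ (Fin n)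

/-- **Kirby 1989, VIII Thm 1(A), proof, first step, per circle:** surgery on a framed circle
`S¹ × ℝ³ ↪ M` in a connected closed smooth `ℤ`-oriented `4`-manifold `(M, μ)` yields a
CONNECTED closed smooth `4`-manifold `M′` (a surgery on `M` along it,
`FramedSphereFamily.IsSurgery.connectedSpace` with `k = 1`, `l = 2`), a `ℤ`-orientation `μ′`
with `(M, μ)` oriented-bordant to `(M′, μ′)` through the trace, and `σ(M′, μ′) = σ(M, μ)`
(`exists_isSurgery_isOrientedBordant_signature_eq`).
[cite: Kirby1989, Ch. VIII Thm 1(A) (proof)] -/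
theorem exists_connectedSpace_isSurgery_isOrientedBordant_signature_eq {M : Type}
    [TopologicalSpace M] [ChartedSpace (𝔼 4) M] [T2Space M] [SecondCountableTopology M]
    [CompactSpace M] [IsManifold (𝓡 4) ∞ M] [ConnectedSpace M] {ι : Type} [Unique ι]
    (ν : FramedSphereFamily (𝓡 4) M ι 1 3) (μ : HomologicalOrientation ℤ M 4) :
    ∃ (M' : Type) (_ : TopologicalSpace M') (_ : ChartedSpace (𝔼 4) M')
      (_ : IsManifold (𝓡 4) ∞ M') (_ : CompactSpace M') (_ : T2Space M') (_ : SecondCountableTopology M')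
      (_ : ConnectedSpace M') (μ' : HomologicalOrientation ℤ M' 4),
      ν.IsSurgery (𝓡 4) M' ∧ IsOrientedBordant 4 μ μ' ∧ μ'.signature = μ.signature := by
  obtain ⟨M', i₁, i₂, i₃, i₄, i₅, i₆, μ', hs, hb, hσ⟩ :=
    exists_isSurgery_isOrientedBordant_signature_eq ν μ
  have hk : 1 + 2 ≤ finrank ℝ (𝔼 4) := by rw [finrank_euclideanSpace_fin]; norm_num
  have hc : ConnectedSpace M' := hs.connectedSpace hk one_le_two
  exact ⟨M', i₁, i₂, i₃, i₄, i₅, i₆, hc, μ', hs, hb, hσ⟩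

end Literature.Topology.FourManifolds
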